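/-
Copyright (c) 2026. Released under Apache 2.0 license as described in the file LICENSE.
-/
import Summits.RiemannHypothesis.RiemannHypothesis.Theorems.LiDirichletKernelPositivityAll
import HarnessLib

/-!
# KERNEL LINEAGE K-χ — the CLASSIFICATION ENGINE: every primitive character of conductor `≤ 13` has tabulated rows

RH-FREE DATA infrastructure (0 kit).  bears_on: LADDER-RH L-D (COLUMN 4 LI, DATA rung; Dirichlet rows; consumers
`LiCriterionDirichlet.lean:95/194/305`).  WHAT THIS IS NOT: nothing here bears on the truth of RH/GRH.

`exists_classRows_of_isPrimitive`: every primitive Dirichlet character of conductor `2 ≤ q ≤ 13` has one of the 23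
tabulated row sets (`classRows q`: the `specQ….rows` of the table modules `LiDirichletKernelTableQ*`, conjugate
characters sharing rows by `rows_of_inv`): for `1 ≤ n ≤ 48`, `Re λ_χ(n) ∈ λ-row n` and `lt_χ(n) = charLiOsc χ n ∈
lt-row n` (`RowsOf`).  This packages the character classification of `LiDirichletKernelPositivity` (prime `q`:
`χ(g)^{q−1} = 1 ⇒ χ(g) = e(k/(q−1))`, `k = 0` principal) and `LiDirichletKernelPositivityAll` (composite `q`: imprimitive
classes discarded by `factorsThrough_of_apply_eq_one`; `q = 2, 6, 10` carry none) ONCE, with the rows as output; every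
ROW-DECIDABLE law then transfers to all 37 characters by one `decide` over the 23 tables
(`LiDirichletKernelStructure`: monotonicity, `|lt_χ(n)| < √n`, `λ_n(ζ) < Re λ_χ(n)`).
-/

set_option linter.dupNamespace false

namespace Summit.RiemannHypothesis.RiemannHypothesis.Theorems.LiDirichletKernel

open Literature.NumberTheory.LFunctions Literature.NumberTheory.LFunctions.LiDirichlet
open Summit.RiemannHypothesis.RiemannHypothesis.Theorems.LiTheory

/-! ## The 23 row tables, by modulus -/

/-- A table of rows `(digits, λ.lo, λ.hi, lt.lo, lt.hi)`, `n = 1, …, 48`. -/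
abbrev RowTable := List (ℕ × ℤ × ℤ × ℤ × ℤ)

/-- The row tables of the primitive characters modulo `q` (one per conjugacy-sharing class; `[]` when there is none). -/
def classRows : ℕ → List RowTable
  | 3 => [specQ3m2.rows]
  | 4 => [specQ4m3.rows]
  | 5 => [specQ5m2.rows, specQ5m4.rows]
  | 7 => [specQ7am2.rows, specQ7am3.rows, specQ7bm6.rows]
  | 8 => [specQ8m3.rows, specQ8m5.rows]
  | 9 => [specQ9am2.rows, specQ9bm4.rows]
  | 11 => [specQ11am2.rows, specQ11am3.rows, specQ11bm5.rows, specQ11bm7.rows, specQ11cm10.rows]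
  | 12 => [specQ12m11.rows]
  | 13 => [specQ13am2.rows, specQ13am3.rows, specQ13bm4.rows, specQ13bm5.rows, specQ13cm6.rows, specQ13cm12.rows]
  | _ => []
/-- `χ` HAS THE ROWS `rows`: for `1 ≤ n ≤ 48`, `Re λ_χ(n)` lies in the `λ`-row `n` and `lt_χ(n) = charLiOsc χ n` in the
`lt`-row `n`. -/
structure RowsOf {q : ℕ} [NeZero q] (χ : DirichletCharacter ℂ q) (rows : RowTable) : Prop where
  /-- row `n`: `Re λ_χ(n)` in the `λ`-row, `lt_χ(n)` in the `lt`-row -/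
  mem : ∀ n : ℕ, 1 ≤ n → n ≤ 48 →
    InRow (liCoeffCharRe χ n) (rowOf rows n).1 (rowOf rows n).2.1 (rowOf rows n).2.2.1 ∧
      InRow (charLiOsc χ n) (rowOf rows n).1 (rowOf rows n).2.2.2.1 (rowOf rows n).2.2.2.2

/-- From a row theorem of a table module. -/
theorem rowsOf_of_row {q : ℕ} [NeZero q] {χ : DirichletCharacter ℂ q} {rows : RowTable}
    (h : ∀ {n : ℕ}, 1 ≤ n → n ≤ 48 →
      InRow (liCoeffCharRe χ n) (rowOf rows n).1 (rowOf rows n).2.1 (rowOf rows n).2.2.1 ∧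
        InRow (charLiOsc χ n) (rowOf rows n).1 (rowOf rows n).2.2.2.1 (rowOf rows n).2.2.2.2 ∧ 0 < liCoeffCharRe χ n) :
    RowsOf χ rows :=
  ⟨fun _ hn hn' ↦ ⟨(h hn hn').1, (h hn hn').2.1⟩⟩

/-! ## Classification: every primitive character of conductor `≤ 13` has tabulated rows -/


/-- **`q = 3`**: every primitive character `mod 3` has one of the tabulated row sets `classRows 3`. -/
theorem exists_rows_q3 (χ : DirichletCharacter ℂ 3) (hprim : χ.IsPrimitive) :
    ∃ rows ∈ classRows 3, RowsOf χ rows := by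
  have hχ : χ ≠ 1 := ne_one_of_isPrimitive' hprim (by norm_num)
  have hpow : χ ((2 : ℕ) : ZMod 3) ^ 2 = 1 := by
    rw [← map_pow, show ((2 : ℕ) : ZMod 3) ^ 2 = 1 by decide, map_one]
  obtain ⟨k, hk, hval⟩ := exists_rootOfUnity_of_pow_eq_one (by norm_num) hpow
  interval_cases k
  · exact absurd (eq_one_of_apply_gen χ (g := 2) (by decide) (by decide) (by rw [hval]; exact rootOfUnity_zero 2)) hχ
  · exact ⟨specQ3m2.rows, by simp [classRows], rowsOf_of_row fun hn hn' ↦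
      liCoeffCharRe_row_q3_m2 χ hval hn hn'⟩

/-- **`q = 4`**: every primitive character `mod 4` has one of the tabulated row sets `classRows 4`. -/
theorem exists_rows_q4 (χ : DirichletCharacter ℂ 4) (hprim : χ.IsPrimitive) :
    ∃ rows ∈ classRows 4, RowsOf χ rows := by
  have hpow : χ ((3 : ℕ) : ZMod 4) ^ 2 = 1 := by
    rw [← map_pow, show ((3 : ℕ) : ZMod 4) ^ 2 = 1 by decide, map_one]
  obtain ⟨k, hk, hval⟩ := exists_rootOfUnity_of_pow_eq_one (by norm_num) hpow
  interval_cases k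
  · exact absurd (eq_one_of_apply_gen χ (g := 3) (by decide) (by decide) (by rw [hval]; exact rootOfUnity_zero 2))
      (ne_one_of_isPrimitive' hprim (by norm_num))
  · exact ⟨specQ4m3.rows, by simp [classRows], rowsOf_of_row fun hn hn' ↦
      liCoeffCharRe_row_q4_m3 χ hval hprim hn hn'⟩

/-- **`q = 5`**: every primitive character `mod 5` has one of the tabulated row sets `classRows 5`. -/
theorem exists_rows_q5 (χ : DirichletCharacter ℂ 5) (hprim : χ.IsPrimitive) :
    ∃ rows ∈ classRows 5, RowsOf χ rows := by
  have hχ : χ ≠ 1 := ne_one_of_isPrimitive' hprim (by norm_num)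
  have hpow : χ ((2 : ℕ) : ZMod 5) ^ 4 = 1 := by
    rw [← map_pow, show ((2 : ℕ) : ZMod 5) ^ 4 = 1 by decide, map_one]
  obtain ⟨k, hk, hval⟩ := exists_rootOfUnity_of_pow_eq_one (by norm_num) hpow
  interval_cases k
  · exact absurd (eq_one_of_apply_gen χ (g := 2) (by decide) (by decide) (by rw [hval]; exact rootOfUnity_zero 4)) hχ
  · exact ⟨specQ5m2.rows, by simp [classRows], rowsOf_of_row fun hn hn' ↦
      liCoeffCharRe_row_q5_m2 χ hval hn hn'⟩
  · exact ⟨specQ5m4.rows, by simp [classRows], rowsOf_of_row fun hn hn' ↦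
      liCoeffCharRe_row_q5_m4 χ (by rw [hval]; exact rootOfUnity_eq_of_mul (a := 2) (by norm_num) (by norm_num) (by norm_num) (by norm_num)) hn hn'⟩
  · exact ⟨specQ5m2.rows, by simp [classRows], rowsOf_of_row fun hn hn' ↦
      liCoeffCharRe_row_q5_m3 χ hval hn hn'⟩

/-- **`q = 7`**: every primitive character `mod 7` has one of the tabulated row sets `classRows 7`. -/
theorem exists_rows_q7 (χ : DirichletCharacter ℂ 7) (hprim : χ.IsPrimitive) :
    ∃ rows ∈ classRows 7, RowsOf χ rows := by
  have hχ : χ ≠ 1 := ne_one_of_isPrimitive' hprim (by norm_num)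
  have hpow : χ ((3 : ℕ) : ZMod 7) ^ 6 = 1 := by
    rw [← map_pow, show ((3 : ℕ) : ZMod 7) ^ 6 = 1 by decide, map_one]
  obtain ⟨k, hk, hval⟩ := exists_rootOfUnity_of_pow_eq_one (by norm_num) hpow
  interval_cases k
  · exact absurd (eq_one_of_apply_gen χ (g := 3) (by decide) (by decide) (by rw [hval]; exact rootOfUnity_zero 6)) hχ
  · exact ⟨specQ7am3.rows, by simp [classRows], rowsOf_of_row fun hn hn' ↦
      liCoeffCharRe_row_q7_m3 χ hval hn hn'⟩
  · exact ⟨specQ7am2.rows, by simp [classRows], rowsOf_of_row fun hn hn' ↦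
      liCoeffCharRe_row_q7_m2 χ (by rw [hval]; exact rootOfUnity_eq_of_mul (a := 2) (by norm_num) (by norm_num) (by norm_num) (by norm_num)) hn hn'⟩
  · exact ⟨specQ7bm6.rows, by simp [classRows], rowsOf_of_row fun hn hn' ↦
      liCoeffCharRe_row_q7_m6 χ (by rw [hval]; exact rootOfUnity_eq_of_mul (a := 3) (by norm_num) (by norm_num) (by norm_num) (by norm_num)) hn hn'⟩
  · exact ⟨specQ7am2.rows, by simp [classRows], rowsOf_of_row fun hn hn' ↦
      liCoeffCharRe_row_q7_m4 χ (by rw [hval]; exact rootOfUnity_eq_of_mul (a := 2) (by norm_num) (by norm_num) (by norm_num) (by norm_num)) hn hn'⟩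
  · exact ⟨specQ7am3.rows, by simp [classRows], rowsOf_of_row fun hn hn' ↦
      liCoeffCharRe_row_q7_m5 χ hval hn hn'⟩

/-- **`q = 8`**: every primitive character `mod 8` has one of the tabulated row sets `classRows 8`. -/
theorem exists_rows_q8 (χ : DirichletCharacter ℂ 8) (hprim : χ.IsPrimitive) :
    ∃ rows ∈ classRows 8, RowsOf χ rows := by
  have hpow5 : χ ((5 : ℕ) : ZMod 8) ^ 2 = 1 := by
    rw [← map_pow, show ((5 : ℕ) : ZMod 8) ^ 2 = 1 by decide, map_one]
  have hpow7 : χ ((7 : ℕ) : ZMod 8) ^ 2 = 1 := by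
    rw [← map_pow, show ((7 : ℕ) : ZMod 8) ^ 2 = 1 by decide, map_one]
  obtain ⟨k, hk, h5⟩ := exists_rootOfUnity_of_pow_eq_one (by norm_num) hpow5
  obtain ⟨j, hj, h7⟩ := exists_rootOfUnity_of_pow_eq_one (by norm_num) hpow7
  interval_cases k
  · refine absurd hprim (not_isPrimitive_of_factorsThrough χ (d := 4) ?_ (by norm_num))
    refine factorsThrough_of_apply_eq_one (by norm_num) χ fun m hm hcop hcast ↦ ?_
    interval_cases m
    all_goals first
      | exact absurd hcop (by decide)
      | exact absurd hcast (by decide)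
      | (rw [Nat.cast_one, map_one])
      | (rw [h5]; exact rootOfUnity_zero 2)
  · interval_cases j
    · exact ⟨specQ8m5.rows, by simp [classRows], rowsOf_of_row fun hn hn' ↦
        liCoeffCharRe_row_q8_m5 χ h7 h5 hprim hn hn'⟩
    · exact ⟨specQ8m3.rows, by simp [classRows], rowsOf_of_row fun hn hn' ↦
        liCoeffCharRe_row_q8_m3 χ h7 h5 hprim hn hn'⟩

/-- **`q = 9`**: every primitive character `mod 9` has one of the tabulated row sets `classRows 9`. -/
theorem exists_rows_q9 (χ : DirichletCharacter ℂ 9) (hprim : χ.IsPrimitive) :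
    ∃ rows ∈ classRows 9, RowsOf χ rows := by
  have hpow : χ ((2 : ℕ) : ZMod 9) ^ 6 = 1 := by
    rw [← map_pow, show ((2 : ℕ) : ZMod 9) ^ 6 = 1 by decide, map_one]
  obtain ⟨k, hk, hval⟩ := exists_rootOfUnity_of_pow_eq_one (by norm_num) hpow
  interval_cases k
  · exact absurd (eq_one_of_apply_gen χ (g := 2) (by decide) (by decide) (by rw [hval]; exact rootOfUnity_zero 6))
      (ne_one_of_isPrimitive' hprim (by norm_num))
  · exact ⟨specQ9am2.rows, by simp [classRows], rowsOf_of_row fun hn hn' ↦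
      liCoeffCharRe_row_q9_m2 χ hval hprim hn hn'⟩
  · have h' : χ ((2 : ℕ) : ZMod 9) = rootOfUnity 3 1 := by
      rw [hval]; exact rootOfUnity_eq_of_mul (a := 2) (by norm_num) (by norm_num) (by norm_num) (by norm_num)
    exact ⟨specQ9bm4.rows, by simp [classRows], rowsOf_of_row fun hn hn' ↦
        liCoeffCharRe_row_q9_m4 χ h' hprim hn hn'⟩
  · refine absurd hprim (not_isPrimitive_of_factorsThrough χ (d := 3) ?_ (by norm_num))
    refine factorsThrough_of_apply_eq_one (by norm_num) χ fun m hm hcop hcast ↦ ?_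
    interval_cases m
    all_goals first
      | exact absurd hcop (by decide)
      | exact absurd hcast (by decide)
      | (rw [Nat.cast_one, map_one])
      | (rw [char_apply_pow_eq χ (g := 2) (m := 4) (e := 2) (d := 6) (k := 3) (t := 0) (by norm_num) hval (by decide)
          (by decide)]; exact rootOfUnity_zero 6)
      | (rw [char_apply_pow_eq χ (g := 2) (m := 7) (e := 4) (d := 6) (k := 3) (t := 0) (by norm_num) hval (by decide)
          (by decide)]; exact rootOfUnity_zero 6)
  · have h' : χ ((2 : ℕ) : ZMod 9) = rootOfUnity 3 2 := by
      rw [hval]; exact rootOfUnity_eq_of_mul (a := 2) (by norm_num) (by norm_num) (by norm_num) (by norm_num)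
    exact ⟨specQ9bm4.rows, by simp [classRows], rowsOf_of_row fun hn hn' ↦
        liCoeffCharRe_row_q9_m7 χ h' hprim hn hn'⟩
  · exact ⟨specQ9am2.rows, by simp [classRows], rowsOf_of_row fun hn hn' ↦
      liCoeffCharRe_row_q9_m5 χ hval hprim hn hn'⟩

/-- **`q = 11`**: every primitive character `mod 11` has one of the tabulated row sets `classRows 11`. -/
theorem exists_rows_q11 (χ : DirichletCharacter ℂ 11) (hprim : χ.IsPrimitive) :
    ∃ rows ∈ classRows 11, RowsOf χ rows := by
  have hχ : χ ≠ 1 := ne_one_of_isPrimitive' hprim (by norm_num)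
  have hpow : χ ((2 : ℕ) : ZMod 11) ^ 10 = 1 := by
    rw [← map_pow, show ((2 : ℕ) : ZMod 11) ^ 10 = 1 by decide, map_one]
  obtain ⟨k, hk, hval⟩ := exists_rootOfUnity_of_pow_eq_one (by norm_num) hpow
  interval_cases k
  · exact absurd (eq_one_of_apply_gen χ (g := 2) (by decide) (by decide) (by rw [hval]; exact rootOfUnity_zero 10)) hχ
  · exact ⟨specQ11am2.rows, by simp [classRows], rowsOf_of_row fun hn hn' ↦
      liCoeffCharRe_row_q11_m2 χ hval hn hn'⟩
  · exact ⟨specQ11am3.rows, by simp [classRows], rowsOf_of_row fun hn hn' ↦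
      liCoeffCharRe_row_q11_m4 χ (by rw [hval]; exact rootOfUnity_eq_of_mul (a := 2) (by norm_num) (by norm_num) (by norm_num) (by norm_num)) hn hn'⟩
  · exact ⟨specQ11bm7.rows, by simp [classRows], rowsOf_of_row fun hn hn' ↦
      liCoeffCharRe_row_q11_m8 χ hval hn hn'⟩
  · exact ⟨specQ11bm5.rows, by simp [classRows], rowsOf_of_row fun hn hn' ↦
      liCoeffCharRe_row_q11_m5 χ (by rw [hval]; exact rootOfUnity_eq_of_mul (a := 2) (by norm_num) (by norm_num) (by norm_num) (by norm_num)) hn hn'⟩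
  · exact ⟨specQ11cm10.rows, by simp [classRows], rowsOf_of_row fun hn hn' ↦
      liCoeffCharRe_row_q11_m10 χ (by rw [hval]; exact rootOfUnity_eq_of_mul (a := 5) (by norm_num) (by norm_num) (by norm_num) (by norm_num)) hn hn'⟩
  · exact ⟨specQ11bm5.rows, by simp [classRows], rowsOf_of_row fun hn hn' ↦
      liCoeffCharRe_row_q11_m9 χ (by rw [hval]; exact rootOfUnity_eq_of_mul (a := 2) (by norm_num) (by norm_num) (by norm_num) (by norm_num)) hn hn'⟩
  · exact ⟨specQ11bm7.rows, by simp [classRows], rowsOf_of_row fun hn hn' ↦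
      liCoeffCharRe_row_q11_m7 χ hval hn hn'⟩
  · exact ⟨specQ11am3.rows, by simp [classRows], rowsOf_of_row fun hn hn' ↦
      liCoeffCharRe_row_q11_m3 χ (by rw [hval]; exact rootOfUnity_eq_of_mul (a := 2) (by norm_num) (by norm_num) (by norm_num) (by norm_num)) hn hn'⟩
  · exact ⟨specQ11am2.rows, by simp [classRows], rowsOf_of_row fun hn hn' ↦
      liCoeffCharRe_row_q11_m6 χ hval hn hn'⟩

/-- **`q = 12`**: every primitive character `mod 12` has one of the tabulated row sets `classRows 12`. -/
theorem exists_rows_q12 (χ : DirichletCharacter ℂ 12) (hprim : χ.IsPrimitive) :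
    ∃ rows ∈ classRows 12, RowsOf χ rows := by
  have hpow5 : χ ((5 : ℕ) : ZMod 12) ^ 2 = 1 := by
    rw [← map_pow, show ((5 : ℕ) : ZMod 12) ^ 2 = 1 by decide, map_one]
  have hpow7 : χ ((7 : ℕ) : ZMod 12) ^ 2 = 1 := by
    rw [← map_pow, show ((7 : ℕ) : ZMod 12) ^ 2 = 1 by decide, map_one]
  obtain ⟨k, hk, h5⟩ := exists_rootOfUnity_of_pow_eq_one (by norm_num) hpow5
  obtain ⟨j, hj, h7⟩ := exists_rootOfUnity_of_pow_eq_one (by norm_num) hpow7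
  interval_cases k
  · refine absurd hprim (not_isPrimitive_of_factorsThrough χ (d := 4) ?_ (by norm_num))
    refine factorsThrough_of_apply_eq_one (by norm_num) χ fun m hm hcop hcast ↦ ?_
    interval_cases m
    all_goals first
      | exact absurd hcop (by decide)
      | exact absurd hcast (by decide)
      | (rw [Nat.cast_one, map_one])
      | (rw [h5]; exact rootOfUnity_zero 2)
  · interval_cases j
    · refine absurd hprim (not_isPrimitive_of_factorsThrough χ (d := 3) ?_ (by norm_num))
      refine factorsThrough_of_apply_eq_one (by norm_num) χ fun m hm hcop hcast ↦ ?_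
      interval_cases m
      all_goals first
        | exact absurd hcop (by decide)
        | exact absurd hcast (by decide)
        | (rw [Nat.cast_one, map_one])
        | (rw [h7]; exact rootOfUnity_zero 2)
    · exact ⟨specQ12m11.rows, by simp [classRows], rowsOf_of_row fun hn hn' ↦
        liCoeffCharRe_row_q12_m11 χ h5 h7 hprim hn hn'⟩

/-- **`q = 13`**: every primitive character `mod 13` has one of the tabulated row sets `classRows 13`. -/
theorem exists_rows_q13 (χ : DirichletCharacter ℂ 13) (hprim : χ.IsPrimitive) :
    ∃ rows ∈ classRows 13, RowsOf χ rows := by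
  have hχ : χ ≠ 1 := ne_one_of_isPrimitive' hprim (by norm_num)
  have hpow : χ ((2 : ℕ) : ZMod 13) ^ 12 = 1 := by
    rw [← map_pow, show ((2 : ℕ) : ZMod 13) ^ 12 = 1 by decide, map_one]
  obtain ⟨k, hk, hval⟩ := exists_rootOfUnity_of_pow_eq_one (by norm_num) hpow
  interval_cases k
  · exact absurd (eq_one_of_apply_gen χ (g := 2) (by decide) (by decide) (by rw [hval]; exact rootOfUnity_zero 12)) hχ
  · exact ⟨specQ13am2.rows, by simp [classRows], rowsOf_of_row fun hn hn' ↦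
      liCoeffCharRe_row_q13_m2 χ hval hn hn'⟩
  · exact ⟨specQ13bm4.rows, by simp [classRows], rowsOf_of_row fun hn hn' ↦
      liCoeffCharRe_row_q13_m4 χ (by rw [hval]; exact rootOfUnity_eq_of_mul (a := 2) (by norm_num) (by norm_num) (by norm_num) (by norm_num)) hn hn'⟩
  · exact ⟨specQ13bm5.rows, by simp [classRows], rowsOf_of_row fun hn hn' ↦
      liCoeffCharRe_row_q13_m8 χ (by rw [hval]; exact rootOfUnity_eq_of_mul (a := 3) (by norm_num) (by norm_num) (by norm_num) (by norm_num)) hn hn'⟩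
  · exact ⟨specQ13am3.rows, by simp [classRows], rowsOf_of_row fun hn hn' ↦
      liCoeffCharRe_row_q13_m3 χ (by rw [hval]; exact rootOfUnity_eq_of_mul (a := 4) (by norm_num) (by norm_num) (by norm_num) (by norm_num)) hn hn'⟩
  · exact ⟨specQ13cm6.rows, by simp [classRows], rowsOf_of_row fun hn hn' ↦
      liCoeffCharRe_row_q13_m6 χ hval hn hn'⟩
  · exact ⟨specQ13cm12.rows, by simp [classRows], rowsOf_of_row fun hn hn' ↦
      liCoeffCharRe_row_q13_m12 χ (by rw [hval]; exact rootOfUnity_eq_of_mul (a := 6) (by norm_num) (by norm_num) (by norm_num) (by norm_num)) hn hn'⟩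
  · exact ⟨specQ13cm6.rows, by simp [classRows], rowsOf_of_row fun hn hn' ↦
      liCoeffCharRe_row_q13_m11 χ hval hn hn'⟩
  · exact ⟨specQ13am3.rows, by simp [classRows], rowsOf_of_row fun hn hn' ↦
      liCoeffCharRe_row_q13_m9 χ (by rw [hval]; exact rootOfUnity_eq_of_mul (a := 4) (by norm_num) (by norm_num) (by norm_num) (by norm_num)) hn hn'⟩
  · exact ⟨specQ13bm5.rows, by simp [classRows], rowsOf_of_row fun hn hn' ↦
      liCoeffCharRe_row_q13_m5 χ (by rw [hval]; exact rootOfUnity_eq_of_mul (a := 3) (by norm_num) (by norm_num) (by norm_num) (by norm_num)) hn hn'⟩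
  · exact ⟨specQ13bm4.rows, by simp [classRows], rowsOf_of_row fun hn hn' ↦
      liCoeffCharRe_row_q13_m10 χ (by rw [hval]; exact rootOfUnity_eq_of_mul (a := 2) (by norm_num) (by norm_num) (by norm_num) (by norm_num)) hn hn'⟩
  · exact ⟨specQ13am2.rows, by simp [classRows], rowsOf_of_row fun hn hn' ↦
      liCoeffCharRe_row_q13_m7 χ hval hn hn'⟩

/-- **THE ENGINE**: every primitive Dirichlet character of conductor `2 ≤ q ≤ 13` has one of the tabulated row sets
`classRows q` (`q = 2, 6, 10` have no primitive character). -/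
theorem exists_classRows_of_isPrimitive {q : ℕ} [NeZero q] (hq : 2 ≤ q) (hq' : q ≤ 13)
    (χ : DirichletCharacter ℂ q) (hprim : χ.IsPrimitive) : ∃ rows ∈ classRows q, RowsOf χ rows := by
  obtain rfl | rfl | rfl | rfl | rfl | rfl | rfl | rfl | rfl | rfl | rfl | rfl :
      q = 2 ∨ q = 3 ∨ q = 4 ∨ q = 5 ∨ q = 6 ∨ q = 7 ∨ q = 8 ∨ q = 9 ∨ q = 10 ∨ q = 11 ∨ q = 12 ∨ q = 13 := by omega
  · exact absurd hprim (not_isPrimitive_of_factorsThrough χ (d := 1)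
      (factorsThrough_of_apply_eq_one (by norm_num) χ fun m hm hcop _ ↦ by
        interval_cases m
        · exact absurd hcop (by decide)
        · rw [Nat.cast_one, map_one]) (by norm_num))
  · exact exists_rows_q3 χ hprim
  · exact exists_rows_q4 χ hprim
  · exact exists_rows_q5 χ hprim
  · exact absurd hprim (not_isPrimitive_q6 χ)
  · exact exists_rows_q7 χ hprim
  · exact exists_rows_q8 χ hprim
  · exact exists_rows_q9 χ hprim
  · exact absurd hprim (not_isPrimitive_q10 χ)
  · exact exists_rows_q11 χ hprim
  · exact exists_rows_q12 χ hprim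
  · exact exists_rows_q13 χ hprim

end Summit.RiemannHypothesis.RiemannHypothesis.Theorems.LiDirichletKernel
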